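import Mathlib
import Summits.Ventures.PercRepro2.HCov
import Summits.Ventures.PercRepro2.GcTransport
import Summits.Ventures.PercRepro2.GcHatConn

/-!
# The hat pushforward: the hat law on the admissible configurations is `c` times the product law
of the two pattern edges (blind cell PercRepro2, typer-1 g56)

For a hat with weights `p₁, p₂, p₃` on `e₁ = {u, a₁}`, `e₂ = {u, a₂}`, `e₃ = {u, w}` the admissible
configurations (`e₁, e₂` not both open) fall into three patterns with masses
`N = (1 − p₃)(1 − p₁p₂) + p₃(1 − p₁)(1 − p₂)` (nothing), `A = p₁(1 − p₂)p₃` (`a₁ – w`),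
`B = (1 − p₁)p₂p₃` (`a₂ – w`). The hat weights put `q₁ = A / (A + N)` on `e₃ = {a₁, w}`,
`q₂ = B / (B + N)` on `e₂ = {w, a₂}` and `0` on the loop `e₁`; with `c = (A + N)(B + N) / N`,

  **`prob_hat_pushforward`** : `P_p(hatMap⁻¹ Y ∩ HatG e₁ e₂) = c · P_{hat}(Y ∩ HatG e₂ e₃)`

for every event `Y` — both sides expanded by the pinning identity at the three gadget edges
(`prob_eq_pin`), the pinned laws the same on both sides, the pinned events the preimages under the
three coordinate fixings (`prob_update_one_eq_preimage` / `_zero_`), and the coefficients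
`N = c(1 − q₁)(1 − q₂)`, `A = c q₁(1 − q₂)`, `B = c(1 − q₁)q₂`. Standard axioms.
-/

namespace Summit.Ventures.PercRepro2

open CovForm RECM

namespace Hat

section Masses

variable {E : Type*} {R : Type*} [Field R]

/-- The mass of the empty pattern. -/
def hatN (p : E → R) (e₁ e₂ e₃ : E) : R :=
  (1 - p e₃) * (1 - p e₁ * p e₂) + p e₃ * (1 - p e₁) * (1 - p e₂)

/-- The mass of the pattern `a₁ – w`. -/
def hatA (p : E → R) (e₁ e₂ e₃ : E) : R := p e₁ * (1 - p e₂) * p e₃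

/-- The mass of the pattern `a₂ – w`. -/
def hatB (p : E → R) (e₁ e₂ e₃ : E) : R := (1 - p e₁) * p e₂ * p e₃

/-- The weight of the pattern edge `e₃ = {a₁, w}` on the hat graph. -/
def hatQ1 (p : E → R) (e₁ e₂ e₃ : E) : R := hatA p e₁ e₂ e₃ / (hatA p e₁ e₂ e₃ + hatN p e₁ e₂ e₃)

/-- The weight of the pattern edge `e₂ = {w, a₂}` on the hat graph. -/
def hatQ2 (p : E → R) (e₁ e₂ e₃ : E) : R := hatB p e₁ e₂ e₃ / (hatB p e₁ e₂ e₃ + hatN p e₁ e₂ e₃)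

/-- The scale of the hat law. -/
def hatC (p : E → R) (e₁ e₂ e₃ : E) : R :=
  (hatA p e₁ e₂ e₃ + hatN p e₁ e₂ e₃) * (hatB p e₁ e₂ e₃ + hatN p e₁ e₂ e₃) / hatN p e₁ e₂ e₃

variable [DecidableEq E]

/-- **The hat weights**: `0` on the loop `e₁`, `q₂` on `e₂ = {w, a₂}`, `q₁` on `e₃ = {a₁, w}`. -/
def hatWeights (p : E → R) (e₁ e₂ e₃ : E) : E → R :=
  Function.update (Function.update (Function.update p e₁ 0) e₂ (hatQ2 p e₁ e₂ e₃)) e₃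
    (hatQ1 p e₁ e₂ e₃)

/-- The three coordinates fixed. -/
def fix3 (e₁ e₂ e₃ : E) (a b c : Bool) (ω : Config E) : Config E :=
  Function.update (Function.update (Function.update ω e₁ a) e₂ b) e₃ c

end Masses

section Pin

variable {E : Type*} [Fintype E] [DecidableEq E] {R : Type*} [Field R] {e₁ e₂ e₃ : E}

/-- `0 / 1` as a weight. -/
def b01 (c : Bool) : R := if c then 1 else 0

/-- A pinned weight at a fixed edge is the fixing of the configuration at that edge. -/
lemma prob_update_b01_eq_preimage (q : E → R) (e : E) (c : Bool) (A : Set (Config E)) :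
    prob (Function.update q e (b01 c)) A = prob q ((fun ω => Function.update ω e c) ⁻¹' A) := by
  cases c
  · exact prob_update_zero_eq_preimage q e A
  · exact prob_update_one_eq_preimage q e A

omit [Fintype E] in
/-- The three nested fixings are `fix3`. -/
lemma fix3_preimage (a b c : Bool) (A : Set (Config E)) :
    (fun ω => Function.update ω e₁ a) ⁻¹' ((fun ω => Function.update ω e₂ b) ⁻¹'
      ((fun ω => Function.update ω e₃ c) ⁻¹' A)) = fix3 e₁ e₂ e₃ a b c ⁻¹' A := rfl

/-- The law pinned to a pattern of the three gadget edges is the law of the fixed configurations. -/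
lemma prob_pin3_eq (q : E → R) (a b c : Bool) (A : Set (Config E)) :
    prob (Function.update (Function.update (Function.update q e₁ (b01 a)) e₂ (b01 b)) e₃ (b01 c))
      A = prob q (fix3 e₁ e₂ e₃ a b c ⁻¹' A) := by
  rw [prob_update_b01_eq_preimage, prob_update_b01_eq_preimage, prob_update_b01_eq_preimage,
    fix3_preimage]

/-- **The pinning identity at the three gadget edges**: the law is the sum over the `8` patterns
of the pattern weight times the law of the configurations fixed to the pattern. -/
theorem prob_eq_pin3 (h12 : e₁ ≠ e₂) (h13 : e₁ ≠ e₃) (h23 : e₂ ≠ e₃) (q : E → R)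
    (A : Set (Config E)) :
    prob q A =
      q e₁ * q e₂ * q e₃ * prob q (fix3 e₁ e₂ e₃ true true true ⁻¹' A) +
      q e₁ * q e₂ * (1 - q e₃) * prob q (fix3 e₁ e₂ e₃ true true false ⁻¹' A) +
      q e₁ * (1 - q e₂) * q e₃ * prob q (fix3 e₁ e₂ e₃ true false true ⁻¹' A) +
      q e₁ * (1 - q e₂) * (1 - q e₃) * prob q (fix3 e₁ e₂ e₃ true false false ⁻¹' A) +
      (1 - q e₁) * q e₂ * q e₃ * prob q (fix3 e₁ e₂ e₃ false true true ⁻¹' A) +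
      (1 - q e₁) * q e₂ * (1 - q e₃) * prob q (fix3 e₁ e₂ e₃ false true false ⁻¹' A) +
      (1 - q e₁) * (1 - q e₂) * q e₃ * prob q (fix3 e₁ e₂ e₃ false false true ⁻¹' A) +
      (1 - q e₁) * (1 - q e₂) * (1 - q e₃) * prob q (fix3 e₁ e₂ e₃ false false false ⁻¹' A) := by
  have t1 : (1 : R) = b01 true := rfl
  have t0 : (0 : R) = b01 false := rfl
  rw [prob_eq_pin q A e₁, prob_eq_pin (Function.update q e₁ 1) A e₂,
    prob_eq_pin (Function.update q e₁ 0) A e₂,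
    prob_eq_pin (Function.update (Function.update q e₁ 1) e₂ 1) A e₃,
    prob_eq_pin (Function.update (Function.update q e₁ 1) e₂ 0) A e₃,
    prob_eq_pin (Function.update (Function.update q e₁ 0) e₂ 1) A e₃,
    prob_eq_pin (Function.update (Function.update q e₁ 0) e₂ 0) A e₃]
  simp only [Function.update_of_ne h12.symm, Function.update_of_ne h13.symm,
    Function.update_of_ne h23.symm]
  rw [t1, t0]
  simp only [prob_pin3_eq]
  ring


omit [Fintype E] in
/-- `fix3` at `e₁`. -/
lemma fix3_e1 (h12 : e₁ ≠ e₂) (h13 : e₁ ≠ e₃) (a b c : Bool) (ω : Config E) :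
    fix3 e₁ e₂ e₃ a b c ω e₁ = a := by
  simp [fix3, Function.update_of_ne h13, Function.update_of_ne h12]

omit [Fintype E] in
/-- `fix3` at `e₂`. -/
lemma fix3_e2 (h23 : e₂ ≠ e₃) (a b c : Bool) (ω : Config E) : fix3 e₁ e₂ e₃ a b c ω e₂ = b := by
  simp [fix3, Function.update_of_ne h23]

omit [Fintype E] in
/-- `fix3` at `e₃`. -/
lemma fix3_e3 (a b c : Bool) (ω : Config E) : fix3 e₁ e₂ e₃ a b c ω e₃ = c := by
  simp [fix3]

omit [Fintype E] in
/-- `fix3` off the gadget. -/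
lemma fix3_of_ne (a b c : Bool) (ω : Config E) {g : E} (g1 : g ≠ e₁) (g2 : g ≠ e₂) (g3 : g ≠ e₃) :
    fix3 e₁ e₂ e₃ a b c ω g = ω g := by
  simp [fix3, Function.update_of_ne g1, Function.update_of_ne g2, Function.update_of_ne g3]

omit [Fintype E] in
/-- **The hat map on a fixed pattern** is the fixed pattern of the two pattern edges. -/
lemma hatMap_fix3 (h12 : e₁ ≠ e₂) (h13 : e₁ ≠ e₃) (h23 : e₂ ≠ e₃) (a b c : Bool) (ω : Config E) :
    hatMap e₁ e₂ e₃ (fix3 e₁ e₂ e₃ a b c ω) = fix3 e₁ e₂ e₃ false (b && c) (a && c) ω := by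
  funext g
  by_cases g3 : g = e₃
  · rw [g3, hatMap_e3, fix3_e1 h12 h13, fix3_e3, fix3_e3]
  by_cases g2 : g = e₂
  · rw [g2]
    simp only [hatMap, Function.update_of_ne h23, Function.update_self, fix3_e2 h23, fix3_e3]
  by_cases g1 : g = e₁
  · rw [g1]
    simp only [hatMap, Function.update_of_ne h13, Function.update_of_ne h12, Function.update_self,
      fix3_e1 h12 h13]
  rw [hatMap_of_ne _ g1 g2 g3, fix3_of_ne _ _ _ _ g1 g2 g3, fix3_of_ne _ _ _ _ g1 g2 g3]

omit [Fintype E] in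
/-- A fixed pattern is admissible for `e₁, e₂` iff `a, b` are not both open. -/
lemma fix3_mem_HatG12 (h12 : e₁ ≠ e₂) (h13 : e₁ ≠ e₃) (h23 : e₂ ≠ e₃) (a b c : Bool)
    (ω : Config E) : fix3 e₁ e₂ e₃ a b c ω ∈ HatG e₁ e₂ ↔ ¬ (a = true ∧ b = true) := by
  simp only [HatG, Set.mem_setOf_eq, fix3_e1 h12 h13, fix3_e2 h23]

omit [Fintype E] in
/-- A fixed pattern is admissible for `e₂, e₃` iff `b, c` are not both open. -/
lemma fix3_mem_HatG23 (h23 : e₂ ≠ e₃) (a b c : Bool) (ω : Config E) :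
    fix3 e₁ e₂ e₃ a b c ω ∈ HatG e₂ e₃ ↔ ¬ (b = true ∧ c = true) := by
  simp only [HatG, Set.mem_setOf_eq, fix3_e2 h23, fix3_e3]

omit [Fintype E] in
/-- The fixed preimage of the hat event, admissible pattern. -/
lemma preimage_hat_of_not (h12 : e₁ ≠ e₂) (h13 : e₁ ≠ e₃) (h23 : e₂ ≠ e₃) {a b : Bool} (c : Bool)
    (hab : ¬ (a = true ∧ b = true)) (Y : Set (Config E)) :
    fix3 e₁ e₂ e₃ a b c ⁻¹' (hatMap e₁ e₂ e₃ ⁻¹' Y ∩ HatG e₁ e₂) =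
      fix3 e₁ e₂ e₃ false (b && c) (a && c) ⁻¹' Y := by
  ext ω
  simp only [Set.mem_preimage, Set.mem_inter_iff, hatMap_fix3 h12 h13 h23,
    fix3_mem_HatG12 h12 h13 h23, hab, not_false_eq_true, and_true]

omit [Fintype E] in
/-- The fixed preimage of the hat event, inadmissible pattern. -/
lemma preimage_hat_of_ab (h12 : e₁ ≠ e₂) (h13 : e₁ ≠ e₃) (h23 : e₂ ≠ e₃) (c : Bool)
    (Y : Set (Config E)) :
    fix3 e₁ e₂ e₃ true true c ⁻¹' (hatMap e₁ e₂ e₃ ⁻¹' Y ∩ HatG e₁ e₂) = ∅ := by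
  ext ω
  simp only [Set.mem_preimage, Set.mem_inter_iff, fix3_mem_HatG12 h12 h13 h23,
    Set.mem_empty_iff_false, iff_false, not_and, and_true, not_true_eq_false]
  exact fun _ => id

omit [Fintype E] in
/-- The fixed preimage of an admissible event on the hat graph, admissible pattern. -/
lemma preimage_hatG23_of_not (h23 : e₂ ≠ e₃) (a : Bool) {b c : Bool} (hbc : ¬ (b = true ∧ c = true))
    (Y : Set (Config E)) :
    fix3 e₁ e₂ e₃ a b c ⁻¹' (Y ∩ HatG e₂ e₃) = fix3 e₁ e₂ e₃ a b c ⁻¹' Y := by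
  ext ω
  simp only [Set.mem_preimage, Set.mem_inter_iff, fix3_mem_HatG23 h23, hbc, not_false_eq_true,
    and_true]

omit [Fintype E] in
/-- The fixed preimage of an admissible event on the hat graph, inadmissible pattern. -/
lemma preimage_hatG23_of_bc (h23 : e₂ ≠ e₃) (a : Bool) (Y : Set (Config E)) :
    fix3 e₁ e₂ e₃ a true true ⁻¹' (Y ∩ HatG e₂ e₃) = ∅ := by
  ext ω
  simp only [Set.mem_preimage, Set.mem_inter_iff, fix3_mem_HatG23 h23, Set.mem_empty_iff_false,
    iff_false, not_and, and_true, not_true_eq_false]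
  exact fun _ => id

omit [Fintype E] in
/-- The hat weights pinned on the gadget are the original weights pinned on the gadget. -/
lemma pin3_hatWeights_eq (h12 : e₁ ≠ e₂) (h13 : e₁ ≠ e₃) (h23 : e₂ ≠ e₃) (p : E → R) (x y z : R) :
    Function.update (Function.update (Function.update (hatWeights p e₁ e₂ e₃) e₁ x) e₂ y) e₃ z =
      Function.update (Function.update (Function.update p e₁ x) e₂ y) e₃ z := by
  funext g
  by_cases g3 : g = e₃
  · rw [g3, Function.update_self, Function.update_self]
  by_cases g2 : g = e₂
  · rw [g2, Function.update_of_ne h23, Function.update_of_ne h23, Function.update_self,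
      Function.update_self]
  by_cases g1 : g = e₁
  · rw [g1, Function.update_of_ne h13, Function.update_of_ne h13, Function.update_of_ne h12,
      Function.update_of_ne h12, Function.update_self, Function.update_self]
  simp only [Function.update_of_ne g3, Function.update_of_ne g2, Function.update_of_ne g1,
    hatWeights]

/-- The hat law and the original law agree on the fixed events. -/
lemma prob_hatWeights_fix3 (h12 : e₁ ≠ e₂) (h13 : e₁ ≠ e₃) (h23 : e₂ ≠ e₃) (p : E → R)
    (a b c : Bool) (A : Set (Config E)) :
    prob (hatWeights p e₁ e₂ e₃) (fix3 e₁ e₂ e₃ a b c ⁻¹' A) = prob p (fix3 e₁ e₂ e₃ a b c ⁻¹' A) := by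
  rw [← prob_pin3_eq, ← prob_pin3_eq, pin3_hatWeights_eq h12 h13 h23]

omit [Fintype E] in
/-- The hat weight of `e₁`. -/
lemma hatWeights_e1 (h12 : e₁ ≠ e₂) (h13 : e₁ ≠ e₃) (p : E → R) : hatWeights p e₁ e₂ e₃ e₁ = 0 := by
  simp [hatWeights, Function.update_of_ne h13, Function.update_of_ne h12]

omit [Fintype E] in
/-- The hat weight of `e₂`. -/
lemma hatWeights_e2 (h23 : e₂ ≠ e₃) (p : E → R) : hatWeights p e₁ e₂ e₃ e₂ = hatQ2 p e₁ e₂ e₃ := by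
  simp [hatWeights, Function.update_of_ne h23]

omit [Fintype E] in
/-- The hat weight of `e₃`. -/
lemma hatWeights_e3 (p : E → R) : hatWeights p e₁ e₂ e₃ e₃ = hatQ1 p e₁ e₂ e₃ := by
  simp [hatWeights]

/-- **THE HAT PUSHFORWARD**: the law of the admissible configurations under the hat map is `c`
times the hat law of the admissible configurations, for every event. -/
theorem prob_hat_pushforward (h12 : e₁ ≠ e₂) (h13 : e₁ ≠ e₃) (h23 : e₂ ≠ e₃) (p : E → R)
    (hN : hatN p e₁ e₂ e₃ ≠ 0) (hAN : hatA p e₁ e₂ e₃ + hatN p e₁ e₂ e₃ ≠ 0)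
    (hBN : hatB p e₁ e₂ e₃ + hatN p e₁ e₂ e₃ ≠ 0) (Y : Set (Config E)) :
    prob p (hatMap e₁ e₂ e₃ ⁻¹' Y ∩ HatG e₁ e₂) =
      hatC p e₁ e₂ e₃ * prob (hatWeights p e₁ e₂ e₃) (Y ∩ HatG e₂ e₃) := by
  rw [prob_eq_pin3 h12 h13 h23 p, prob_eq_pin3 h12 h13 h23 (hatWeights p e₁ e₂ e₃)]
  rw [preimage_hat_of_ab h12 h13 h23, preimage_hat_of_ab h12 h13 h23,
    preimage_hat_of_not h12 h13 h23 true (by simp), preimage_hat_of_not h12 h13 h23 false (by simp),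
    preimage_hat_of_not h12 h13 h23 true (by simp), preimage_hat_of_not h12 h13 h23 false (by simp),
    preimage_hat_of_not h12 h13 h23 true (by simp), preimage_hat_of_not h12 h13 h23 false (by simp)]
  rw [preimage_hatG23_of_bc h23, preimage_hatG23_of_bc h23,
    preimage_hatG23_of_not h23 true (by simp), preimage_hatG23_of_not h23 true (by simp),
    preimage_hatG23_of_not h23 true (by simp), preimage_hatG23_of_not h23 false (by simp),
    preimage_hatG23_of_not h23 false (by simp), preimage_hatG23_of_not h23 false (by simp)]
  simp only [prob_hatWeights_fix3 h12 h13 h23, hatWeights_e1 h12 h13, hatWeights_e2 h23,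
    hatWeights_e3, prob_empty, Bool.and_self, Bool.and_false, Bool.and_true]
  have hA : hatA p e₁ e₂ e₃ = p e₁ * (1 - p e₂) * p e₃ := rfl
  have hB : hatB p e₁ e₂ e₃ = (1 - p e₁) * p e₂ * p e₃ := rfl
  have hNN : hatN p e₁ e₂ e₃ = (1 - p e₃) * (1 - p e₁ * p e₂) + p e₃ * (1 - p e₁) * (1 - p e₂) := rfl
  unfold hatC hatQ1 hatQ2
  field_simp
  rw [hA, hB, hNN]
  ring

end Pin

end Hat

end Summit.Ventures.PercRepro2
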